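import Summits.AtomisticToContinuum.FouriersLaw.Theorems.BondHeatUncertaintySubdiffusiveBondHeatSpectralPositivity
import Summits.AtomisticToContinuum.FouriersLaw.Theorems.BondHeatUncertaintySubdiffusiveBondHeatEscapeDeficitNonneg

/-!
# The boundary noise spectrum is nonnegative, `N`-uniformly: `0 ≤ ∫₀^∞ cos(ωu) K_N(u) du` for every `ω`

Crux `stmt-AtomisticToContinuum-9120` (`BondHeatUncertainty.SubdiffusiveBondHeat`, (S)), line `bath-bond-deficit-integral`
(lead c5).  Notation VERBATIM the `let K / E` of route `BoundaryEscapeDeficit`: `K_N(u) = ∫ (p₀² − T)·P_u(p₀² − T) dμ_T^N`,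
`E_N = 1 − (γ/T²)∫_{(0,∞)} K_N`; the boundary NOISE SPECTRUM is `s_N(ω) = 2∫₀^∞ cos(ωu) K_N(u) du` and the WARBURG DIP is
`M_N(ω) := (γ/T²)∫₀^∞ (1 − cos ωu) K_N(u) du = (γ/2T²)(s_N(0) − s_N(ω))` (crux-strategist s2, `STRATEGY-CENSUS.md` §Strengthen).

* `integral_Ioi_nonneg_of_lagIntegral_nonneg` — the Fejér step in the abstract: a bounded measurable `g ∈ L¹(0,∞)` with
  `∫₀ᵗ (t − r) g(r) dr ≥ 0` for all `t ≥ 0` has `∫₀^∞ g ≥ 0` (`∫₀ᵗ (t − r) g = ∫₀ᵗ ∫₀ˢ g` and `∫₀ˢ g → ∫₀^∞ g`);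
* `pinnedChain_cosTransform_kinCorr_nonneg` — **`0 ≤ ∫₀^∞ cos(ωu) K_N(u) du` for every `ω`, every `N ≥ 1`** (Bochner's
  easy direction for the stationary autocorrelation `K_N`, from `pinnedChain_lagIntegral_cos_kinCorr_nonneg`);
  `cosTransform_kinCorr_nonneg` — the same in the route's `dite` spelling, every `N : ℕ`;
* `warburgDip_le_oneSubEscapeDeficit` — **`M_N(ω) ≤ 1 − E_N` for every `ω` and every `N`**, and with the landed
  `escapeDeficit_nonneg` (p139693): `warburgDip_le_one` — **`M_N(ω) ≤ 1` for every `ω`, every `N ≥ 2`**: the dip of the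
  boundary noise spectrum below its DC value never exceeds the DC value itself — the free, phonon-true, all-frequency half
  of the spectral form of the crux's missing Edwards–Wilkinson factor (`ContactWarburgModulus`: `M_N(ω) ≤ C√|ω|` on
  `|ω| ≤ 1`), used as the high-frequency input of the spectral transfer `ContactWarburgModulus ⟹ TransientEW`.

Fixed-`N` technology used `N`-uniformly; nothing here closes the item.
-/

noncomputable section

open MeasureTheory Set Filter Topology intervalIntegral
open scoped NNReal

namespace Summit.AtomisticToContinuum.FouriersLaw.Theorems.SubdiffusiveBondHeat

open Literature.MathematicalPhysics.KineticTheory.HeatConduction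

/-! ### The Fejér step, in the abstract -/

/-- **Fejér / Cesàro step.**  If `g` is measurable, bounded, integrable on `(0,∞)` and `∫₀ᵗ (t − r) g(r) dr ≥ 0` for every
`t ≥ 0`, then `∫_{(0,∞)} g ≥ 0`.  Proof: `∫₀ᵗ (t − r) g = ∫₀ᵗ F` with `F(s) = ∫₀ˢ g → I := ∫_{(0,∞)} g`; if `I < 0` then
`F ≤ I/2` beyond some `s₁`, so `∫₀ᵗ F ≤ B s₁² + (t − s₁) I/2 < 0` for `t` large. [folklore] -/
theorem integral_Ioi_nonneg_of_lagIntegral_nonneg {g : ℝ → ℝ} (hgm : Measurable g) {B : ℝ} (hB : ∀ r, |g r| ≤ B)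
    (hgi : IntegrableOn g (Ioi 0)) (h : ∀ t : ℝ, 0 ≤ t → 0 ≤ ∫ r in (0 : ℝ)..t, (t - r) * g r) :
    0 ≤ ∫ u in Ioi 0, g u := by
  by_contra hneg
  rw [not_le] at hneg
  set I : ℝ := ∫ u in Ioi 0, g u with hI
  have hB0 : 0 ≤ B := (abs_nonneg _).trans (hB 0)
  -- the primitive and its limit
  set F : ℝ → ℝ := fun s => ∫ r in (0 : ℝ)..s, g r with hF
  have hFt : Tendsto F atTop (𝓝 I) := intervalIntegral_tendsto_integral_Ioi 0 hgi tendsto_id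
  have hgii : ∀ a b : ℝ, IntervalIntegrable g volume a b := intervalIntegrable_of_bounded_measurable hgm hB
  have hFc : Continuous F := continuous_primitive hgii 0
  -- eventually `F ≤ I/2`
  have hev : ∀ᶠ s in atTop, F s ≤ I / 2 := by
    have hlt : I < I / 2 := by linarith
    exact (hFt.eventually (gt_mem_nhds hlt)).mono fun s hs => hs.le
  obtain ⟨s₀, hs₀⟩ := eventually_atTop.1 hev
  set s₁ : ℝ := max s₀ 0 with hs₁
  have hs₁0 : 0 ≤ s₁ := le_max_right _ _
  have hFle : ∀ s, s₁ ≤ s → F s ≤ I / 2 := fun s hs => hs₀ s ((le_max_left _ _).trans hs)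
  -- `|F s| ≤ B s₁` on `[0, s₁]`
  have hFb : ∀ s ∈ Icc (0 : ℝ) s₁, |F s| ≤ B * s₁ := by
    intro s hs
    have h1 : |F s| ≤ B * |s - 0| := by
      simp only [hF]
      rw [← Real.norm_eq_abs]
      refine intervalIntegral.norm_integral_le_of_norm_le_const fun r _ => ?_
      rw [Real.norm_eq_abs]; exact hB r
    rw [sub_zero, abs_of_nonneg hs.1] at h1
    exact h1.trans (mul_le_mul_of_nonneg_left hs.2 hB0)
  -- choose `t` beyond `s₁` so large that `B s₁² + (t − s₁) I/2 < 0`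
  set t : ℝ := s₁ + (2 * (B * s₁ * s₁) + 2) / (-I) with ht
  have hIpos : 0 < -I := by linarith
  have hts : s₁ ≤ t := by
    rw [ht]
    have : 0 ≤ (2 * (B * s₁ * s₁) + 2) / (-I) := div_nonneg (by positivity) hIpos.le
    linarith
  have ht0 : 0 ≤ t := hs₁0.trans hts
  have hkey : (t - s₁) * (I / 2) = -(B * s₁ * s₁) - 1 := by
    have hI0 : I ≠ 0 := hneg.ne
    rw [ht]
    field_simp
    ring
  -- `∫₀ᵗ (t − r) g = ∫₀ᵗ F = ∫₀^{s₁} F + ∫_{s₁}^t F`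
  have htri := integral_integral_triangle_eq hgm hB ht0
  have hsplit : ∫ s in (0 : ℝ)..t, F s = (∫ s in (0 : ℝ)..s₁, F s) + ∫ s in s₁..t, F s :=
    (intervalIntegral.integral_add_adjacent_intervals (hFc.intervalIntegrable _ _) (hFc.intervalIntegrable _ _)).symm
  have h1 : ∫ s in (0 : ℝ)..s₁, F s ≤ B * s₁ * s₁ := by
    have h2 : |∫ s in (0 : ℝ)..s₁, F s| ≤ B * s₁ * |s₁ - 0| := by
      rw [← Real.norm_eq_abs]
      refine intervalIntegral.norm_integral_le_of_norm_le_const fun s hs => ?_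
      rw [Real.norm_eq_abs]
      rw [uIoc_of_le hs₁0] at hs
      exact hFb s ⟨hs.1.le, hs.2⟩
    rw [sub_zero, abs_of_nonneg hs₁0] at h2
    exact (le_abs_self _).trans h2
  have h2 : ∫ s in s₁..t, F s ≤ ∫ _ in s₁..t, I / 2 :=
    intervalIntegral.integral_mono_on hts (hFc.intervalIntegrable _ _) intervalIntegrable_const
      fun s hs => hFle s hs.1
  rw [intervalIntegral.integral_const, smul_eq_mul] at h2
  have h3 := h t ht0
  rw [← htri, hsplit] at h3
  nlinarith [h1, h2, hkey]

/-! ### The boundary kinetic observable -/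

section FixedN

variable {ω₂ lam β γ T : ℝ} (hω : 0 < ω₂) (hl : 0 < lam) (hβ : 0 < β) (hγ : 0 < γ) (hT : 0 < T) {N : ℕ}
  (hN : 0 < N)
include hω hl hβ hγ hT hN

/-- **The boundary noise spectrum is nonnegative**: `0 ≤ ∫_{(0,∞)} cos(ωu) K_N(u) du` for every `ω` and every `N ≥ 1`
— Bochner's theorem (easy direction) for the stationary autocorrelation `K_N` of `p₀² − T`: Fejér positivity
(`pinnedChain_lagIntegral_cos_kinCorr_nonneg`) + the Fejér step (`K_N` continuous, `|K_N| ≤ 2T²`, `K_N ∈ L¹(0,∞)` from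
`BoundaryKernelBasics`).  At `ω = 0` it is `E_N ≤ 1` (`pinnedChain_escapeDeficit_le_one`). [folklore] -/
theorem pinnedChain_cosTransform_kinCorr_nonneg (ω : ℝ) :
    0 ≤ ∫ u in Ioi (0 : ℝ), Real.cos (ω * u) *
        ∫ z, ((z.2 ⟨0, hN⟩) ^ 2 - T) *
            (∫ y, ((y.2 ⟨0, hN⟩) ^ 2 - T) ∂((pinnedChain ω₂ lam β γ).transitionKernel N T T u.toNNReal z))
          ∂((pinnedChain ω₂ lam β γ).gibbsMeasure N T) := by
  obtain ⟨-, hKc, hKb, -, hKi⟩ := boundaryKernelBasics_proof ω₂ lam β γ hω hl hβ hγ T hT N hN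
  simp only [dif_pos hN] at hKc hKb hKi
  set K : ℝ → ℝ := fun u => ∫ z, ((z.2 ⟨0, hN⟩) ^ 2 - T) *
      (∫ y, ((y.2 ⟨0, hN⟩) ^ 2 - T) ∂((pinnedChain ω₂ lam β γ).transitionKernel N T T u.toNNReal z))
    ∂((pinnedChain ω₂ lam β γ).gibbsMeasure N T) with hK
  have hcm : Measurable fun u : ℝ => Real.cos (ω * u) := by fun_prop
  have hcc : Continuous fun u : ℝ => Real.cos (ω * u) := by fun_prop
  have hgm : Measurable fun u : ℝ => Real.cos (ω * u) * K u := hcm.mul hKc.measurable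
  have hgB : ∀ u : ℝ, |Real.cos (ω * u) * K u| ≤ 2 * T ^ 2 := by
    intro u
    rw [abs_mul]
    calc |Real.cos (ω * u)| * |K u| ≤ 1 * (2 * T ^ 2) :=
          mul_le_mul (Real.abs_cos_le_one _) (hKb u) (abs_nonneg _) zero_le_one
      _ = 2 * T ^ 2 := by ring
  have hgi : IntegrableOn (fun u : ℝ => Real.cos (ω * u) * K u) (Ioi 0) := by
    refine Integrable.bdd_mul (c := 1) hKi hcc.aestronglyMeasurable.restrict (Eventually.of_forall fun u => ?_)
    rw [Real.norm_eq_abs]; exact Real.abs_cos_le_one _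
  refine integral_Ioi_nonneg_of_lagIntegral_nonneg hgm hgB hgi fun t ht => ?_
  have h := pinnedChain_lagIntegral_cos_kinCorr_nonneg hω hl hβ hγ hT hN ω ht
  simpa only [hK] using h

/-- **Warburg dip ≤ DC level** (`N ≥ 1`, every `ω`): `(γ/T²)∫_{(0,∞)} (1 − cos ωu) K_N(u) du ≤ (γ/T²)∫_{(0,∞)} K_N = 1 − E_N`.
[folklore] -/
theorem pinnedChain_warburgDip_le (ω : ℝ) :
    γ / T ^ 2 * (∫ u in Ioi (0 : ℝ), (1 - Real.cos (ω * u)) *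
        ∫ z, ((z.2 ⟨0, hN⟩) ^ 2 - T) *
            (∫ y, ((y.2 ⟨0, hN⟩) ^ 2 - T) ∂((pinnedChain ω₂ lam β γ).transitionKernel N T T u.toNNReal z))
          ∂((pinnedChain ω₂ lam β γ).gibbsMeasure N T)) ≤
      γ / T ^ 2 * ∫ u in Ioi (0 : ℝ),
        ∫ z, ((z.2 ⟨0, hN⟩) ^ 2 - T) *
            (∫ y, ((y.2 ⟨0, hN⟩) ^ 2 - T) ∂((pinnedChain ω₂ lam β γ).transitionKernel N T T u.toNNReal z))
          ∂((pinnedChain ω₂ lam β γ).gibbsMeasure N T) := by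
  obtain ⟨-, hKc, hKb, -, hKi⟩ := boundaryKernelBasics_proof ω₂ lam β γ hω hl hβ hγ T hT N hN
  simp only [dif_pos hN] at hKc hKb hKi
  set K : ℝ → ℝ := fun u => ∫ z, ((z.2 ⟨0, hN⟩) ^ 2 - T) *
      (∫ y, ((y.2 ⟨0, hN⟩) ^ 2 - T) ∂((pinnedChain ω₂ lam β γ).transitionKernel N T T u.toNNReal z))
    ∂((pinnedChain ω₂ lam β γ).gibbsMeasure N T) with hK
  have hcc : Continuous fun u : ℝ => Real.cos (ω * u) := by fun_prop
  have hgi : IntegrableOn (fun u : ℝ => Real.cos (ω * u) * K u) (Ioi 0) := by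
    refine Integrable.bdd_mul (c := 1) hKi hcc.aestronglyMeasurable.restrict (Eventually.of_forall fun u => ?_)
    rw [Real.norm_eq_abs]; exact Real.abs_cos_le_one _
  have hsplit : ∫ u in Ioi (0 : ℝ), (1 - Real.cos (ω * u)) * K u =
      (∫ u in Ioi (0 : ℝ), K u) - ∫ u in Ioi (0 : ℝ), Real.cos (ω * u) * K u := by
    rw [← integral_sub hKi hgi]
    refine integral_congr_ae (Eventually.of_forall fun u => ?_)
    ring
  have hpos := pinnedChain_cosTransform_kinCorr_nonneg hω hl hβ hγ hT hN ω
  have hγT : 0 ≤ γ / T ^ 2 := div_nonneg hγ.le (by positivity)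
  have hle : ∫ u in Ioi (0 : ℝ), (1 - Real.cos (ω * u)) * K u ≤ ∫ u in Ioi (0 : ℝ), K u := by
    rw [hsplit]
    simp only [hK] at hpos ⊢
    linarith
  exact mul_le_mul_of_nonneg_left hle hγT

end FixedN

/-! ### `∀`-forms in the route's `dite` spelling -/

/-- **Nonnegative boundary noise spectrum, `dite` spelling** (every `N : ℕ`; for `N = 0` the kernel is the junk `0`):
`0 ≤ ∫_{(0,∞)} cos(ωu) K_N(u) du` for all parameters `> 0`, `T > 0`, `N`, `ω`. [folklore] -/
theorem cosTransform_kinCorr_nonneg :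
    ∀ ω₂ lam β γ : ℝ, 0 < ω₂ → 0 < lam → 0 < β → 0 < γ → ∀ T : ℝ, 0 < T → ∀ (N : ℕ) (ω : ℝ), 0 ≤ ∫ u in Set.Ioi (0 : ℝ), Real.cos (ω * u) * (if h : 0 < N then ∫ z, ((z.2 ⟨0, h⟩) ^ 2 - T) * (∫ y, ((y.2 ⟨0, h⟩) ^ 2 - T) ∂((Literature.MathematicalPhysics.KineticTheory.HeatConduction.pinnedChain ω₂ lam β γ).transitionKernel N T T u.toNNReal z)) ∂((Literature.MathematicalPhysics.KineticTheory.HeatConduction.pinnedChain ω₂ lam β γ).gibbsMeasure N T) else 0) := by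
  intro ω₂ lam β γ hω hl hβ hγ T hT N ω
  rcases Nat.eq_zero_or_pos N with rfl | hN
  · simp
  · simp only [dif_pos hN]
    exact pinnedChain_cosTransform_kinCorr_nonneg hω hl hβ hγ hT hN ω

/-- **Warburg dip ≤ `1 − E_N`, `dite` spelling** (every `N : ℕ`, every `ω`):
`(γ/T²)∫_{(0,∞)} (1 − cos ωu) K_N ≤ (γ/T²)∫_{(0,∞)} K_N` (`= 1 − E_N`). [folklore] -/
theorem warburgDip_le_oneSubEscapeDeficit :
    ∀ ω₂ lam β γ : ℝ, 0 < ω₂ → 0 < lam → 0 < β → 0 < γ → ∀ T : ℝ, 0 < T → ∀ (N : ℕ) (ω : ℝ),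
      γ / T ^ 2 * (∫ u in Set.Ioi (0 : ℝ), (1 - Real.cos (ω * u)) *
        (if h : 0 < N then
          ∫ z, ((z.2 ⟨0, h⟩) ^ 2 - T) *
              (∫ y, ((y.2 ⟨0, h⟩) ^ 2 - T) ∂((pinnedChain ω₂ lam β γ).transitionKernel N T T u.toNNReal z))
            ∂((pinnedChain ω₂ lam β γ).gibbsMeasure N T)
        else 0)) ≤
      γ / T ^ 2 * (∫ u in Set.Ioi (0 : ℝ),
        if h : 0 < N then
          ∫ z, ((z.2 ⟨0, h⟩) ^ 2 - T) *
              (∫ y, ((y.2 ⟨0, h⟩) ^ 2 - T) ∂((pinnedChain ω₂ lam β γ).transitionKernel N T T u.toNNReal z))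
            ∂((pinnedChain ω₂ lam β γ).gibbsMeasure N T)
        else 0) := by
  intro ω₂ lam β γ hω hl hβ hγ T hT N ω
  rcases Nat.eq_zero_or_pos N with rfl | hN
  · simp
  · simp only [dif_pos hN]
    exact pinnedChain_warburgDip_le hω hl hβ hγ hT hN ω

/-- **Warburg dip ≤ 1, uniformly in `N ≥ 2` and `ω`**: `(γ/T²)∫_{(0,∞)} (1 − cos ωu) K_N(u) du ≤ 1` — the free
all-frequency half of the spectral Edwards–Wilkinson factor (`warburgDip_le_oneSubEscapeDeficit` + `escapeDeficit_nonneg`).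
[folklore] -/
theorem warburgDip_le_one :
    ∀ ω₂ lam β γ : ℝ, 0 < ω₂ → 0 < lam → 0 < β → 0 < γ → ∀ T : ℝ, 0 < T → ∀ N : ℕ, 2 ≤ N → ∀ ω : ℝ,
      γ / T ^ 2 * (∫ u in Set.Ioi (0 : ℝ), (1 - Real.cos (ω * u)) *
        (if h : 0 < N then
          ∫ z, ((z.2 ⟨0, h⟩) ^ 2 - T) *
              (∫ y, ((y.2 ⟨0, h⟩) ^ 2 - T) ∂((pinnedChain ω₂ lam β γ).transitionKernel N T T u.toNNReal z))
            ∂((pinnedChain ω₂ lam β γ).gibbsMeasure N T)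
        else 0)) ≤ 1 := by
  intro ω₂ lam β γ hω hl hβ hγ T hT N hN ω
  have h1 := warburgDip_le_oneSubEscapeDeficit ω₂ lam β γ hω hl hβ hγ T hT N ω
  have h2 := escapeDeficit_nonneg ω₂ lam β γ hω hl hβ hγ T hT N hN
  linarith

end Summit.AtomisticToContinuum.FouriersLaw.Theorems.SubdiffusiveBondHeat

end
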